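import Summits.BirchSwinnertonDyer.BirchSwinnertonDyer.Theorems.EisensteinDepletionAtTwoStarDoorThreePrints
import Summits.BirchSwinnertonDyer.BirchSwinnertonDyer.Theorems.EisensteinDepletionAtTwoStarRestrictedGlue
import HarnessLib

/-!
# Crux E1M_NSF `DepletedLambdaLawAtTwoModNSF` (stmt-BirchSwinnertonDyer-27021) in the currency of line `star` v16: ONE set of three named facts
# for both E1M (20341) and E1M_NSF (27021) (lead star-p1 GEN 20)

The tenure door of GEN 14 (`KummerDoor.depletedLambdaLawAtTwoModNSF_of_modularity_gamma1_abbesUllmo_ubd`, Theorems/…StarE1MNSFDoor) reads the re-targeted crux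
E1M_NSF modulo modularity + {optimal `Γ₁(N)`-datum, Abbes–Ullmo, UBD}.  GEN 20's all-levels node-law chain (Theorems/…StarDoorThreePrints) gives the aside E1M
(20341) modulo modularity + {(F) cusp non-singularity, Abbes–Ullmo, UBD}; restricting the carrier class (`depletedLambdaLawAtTwoModNSF_of_depletedLambdaLawAtTwoMod`,
GEN 6) puts E1M_NSF in the SAME currency:

* `depletedLambdaLawAtTwoModNSF_of_threePrints : (F) → Abbes–Ullmo → UBD → DepletedLambdaLawAtTwoModNSF` (modularity is the item's own first binder);
* `starGO2Sigma_and_starOptBNSF_of_threePrints` — both registered children of 27021 (`StarGO2Sigma` 27046, `StarOptBNSF` 27047) from modularity + the same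
  three facts, recorded as a conjunction for the tenure planner's bookkeeping.

This is an ALTERNATIVE reading, not a strengthening: it trades the `Γ₁(N)`-datum for (F) on 27021 (both are CES 2003 §6.1 facts about `X₁(N)`-parametrisations);
on 20341 the trade is a strict removal (v15's four prints ⊋ v16's three).  HONEST FRAMING (Barrier B1): CONDITIONAL results; items 27021 / 27046 / 27047 / 20341,
the leaf T-r3₂ and BSD are NOT proved (PARTITION D-0054: none — r_an ≥ 2, axis S0; no S0 motion).  No `sorry`, no definition.
-/

set_option linter.dupNamespace false
set_option autoImplicit false

noncomputable section

open Literature.NumberTheory.EllipticCurves Literature.NumberTheory.EllipticCurves.ModularForms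

namespace Summit.BirchSwinnertonDyer.BirchSwinnertonDyer.Theorems.DepletionAtTwo.SigmaNode

/-- **E1M_NSF (crux item 27021) from THREE named published facts, BY NAME** — `depletedLambdaLawAtTwoMod_of_threePrints` (E1M, all conductors) restricted to
non-squarefree conductors by `depletedLambdaLawAtTwoModNSF_of_depletedLambdaLawAtTwoMod`.  CONDITIONAL on (F), Abbes–Ullmo, UBD; 27021 NOT closed.
[cite: GreenbergVatsal2000, §3 Thm. (3.12), display (28)] [cite: ConradEdixhovenStein2003, §6.1.2 proof of Lemma 6.1.6 (p. 381)] [cite: AbbesUllmo1996, Thm. A]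
[cite: CalegariDimitrovTang2025, Thm. 1.0.1] -/
theorem depletedLambdaLawAtTwoModNSF_of_threePrints (hF : gamma1Parametrization_cuspImage_nonsingularReduction)
    (hAU : abbesUllmo_not_dvd_maninConstant_of_not_dvd_level)
    (hU : Literature.NumberTheory.Automorphic.CalegariDimitrovTang2025_unboundedDenominators) :
    Summit.BirchSwinnertonDyer.BirchSwinnertonDyer.Theses.EisensteinDepletionAtTwo.DepletedLambdaLawAtTwoModNSF :=
  depletedLambdaLawAtTwoModNSF_of_depletedLambdaLawAtTwoMod (depletedLambdaLawAtTwoMod_of_threePrints hF hAU hU)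

/-- **Both registered children of 27021 in the same currency**: `StarGO2Sigma` (27046) from modularity + Abbes–Ullmo + UBD (line kummer's door
`KummerDoor.starGO2Sigma_of_modularity_abbesUllmo_ubd`) and `StarOptBNSF` (27047) from (F) + UBD (`starOptBNSF_of_twoPrints`).  CONDITIONAL; neither item is closed.
[cite: Stevens1982, §2.5] [cite: ConradEdixhovenStein2003, §6.1.2 proof of Lemma 6.1.6 (p. 381)] [cite: CalegariDimitrovTang2025, Thm. 1.0.1] -/
theorem starGO2Sigma_and_starOptBNSF_of_threePrints (hnf : exists_isNewformOf) (hF : gamma1Parametrization_cuspImage_nonsingularReduction)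
    (hAU : abbesUllmo_not_dvd_maninConstant_of_not_dvd_level)
    (hU : Literature.NumberTheory.Automorphic.CalegariDimitrovTang2025_unboundedDenominators) :
    Summit.BirchSwinnertonDyer.BirchSwinnertonDyer.Theses.EisensteinDepletionAtTwo.StarGO2Sigma ∧
      Summit.BirchSwinnertonDyer.BirchSwinnertonDyer.Theses.EisensteinDepletionAtTwo.StarOptBNSF :=
  ⟨KummerDoor.starGO2Sigma_of_modularity_abbesUllmo_ubd hnf hAU hU, starOptBNSF_of_twoPrints hF hU⟩

end Summit.BirchSwinnertonDyer.BirchSwinnertonDyer.Theorems.DepletionAtTwo.SigmaNode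

end
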